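/-
Copyright (c) 2026 the pub-hodgecm-mathlib formalisation cell (harness21).  Prover seat hodgecm-mathlib-R90-C10-p07 (g2) acting for R90-TF section S8 «ContSpec-n½»
(dealer R90-CS-plan (g3)): FILE 3 — the inert torus-entry WITNESS of ★ `K2E1ChiLocalMeansOfShellU3Letters.hin_of_torusEntries`, packaged from ★ FILE 2
`K2E1BigCellIwasawaTorusEntryU3Letters` for a weight read on the Borel part of any Iwasawa factorisation (inert twin of ★ `K2E1BigCellIwasawaTorusEntrySplitU3Letters`).
-/
import Summits.HodgeConjecture.HodgeConjecture.Theorems.K2E1BigCellIwasawaTorusEntryU3Letters   -- ★ FILE 2 (p863569): HEAD `exists_torusEntry_iwasawa_letters`, `exists_heis_of_corner`; brings ★ FILE 1 (p863210)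
import HarnessLib

/-!
# K2·E1 ∕ R90·S8 — `K2E1BigCellIwasawaTorusEntryU3Witness`: THE INERT TORUS-ENTRY WITNESS `∃ α, (α) ∧ (c-on) ∧ (c-off)` OF ★ `hin_of_torusEntries`, FROM A FACTORISATION-READ WEIGHT

Cell `pub/hodgecm-mathlib`, crux h413 = `stmt-HodgeConjecture-24833`, route of record `HCCMUnconditional`; R90-TF section S8 «ContSpec-n½» (the (V) scalar road:
★ (a-1) `K2E1ChiIntertwiningScalarEulerProductU3Finite` ← ★ `K2E1ChiLocalMeansOfShellU3Letters.hin_of_torusEntries` (its `hT`) ← THIS FILE ← ★ FILE 2 ← ★ FILE 1).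
THEOREMS ONLY (no `def`, no `instance`, no notation, no named-fact hypothesis, no `sorry`; default heartbeats); lane `--supports stmt-HodgeConjecture-24833 --as helper` (count-neutral).

THE MATHEMATICS ([Rogawski1990] §4.5 p. 45, §13.9 p. 229; [Casselman1980] §3).  At a good inert place `v` of `L⁺` (unramified, non-split, `v ∤ 2`, `δ` a `w`-unit) the weight of a
`χ`-section along the big cell is `ω(p) = φ_v(w₀·u(X(p), Z(p)))∕φ_v(1)`; for a section that is right-`K_v`-invariant and `(B, χ)`-equivariant this number is READ ON THE BOREL PART of ANY
Iwasawa factorisation `w₀·u = b·k` as `χ_w((b₀₀)_w)` — the hypothesis `hω` below (a property of `ω`, dischargeable in one line by the section's owner; the trivial factorisation `b = 1`,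
`k = w₀·u` on the unit shell gives `ω = 1`).  From ★ FILE 2's HEAD (`α(p) = σ(Z(p))_w⁻¹`, `‖α‖·Q_v = 1`, the factorisations off the unit shell and `w₀·u ∈ K_v` on it) this file assembles
**`exists_inert_torusEntry_witness`**: `∃ α, (∀ p, Q_v p > 1 → ‖α p‖_w·Q_v p = 1) ∧ (∀ p, Q_v p = 1 → ω p = 1) ∧ (∀ p, Q_v p > 1 → ω p = χ_w(α p))` — the `hT v hv w hw` body of
★ `K2E1ChiLocalMeansOfShellU3Letters.hin_of_torusEntries`, BYTE FOR BYTE at `χw := φ.localComponent w.1`; and `exists_antidiag` (an element `w₀` of matrix `Φ₃` exists in `U(Φ₃)(L⁺_v)`, so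
the `w₀` parameter of FILES 1–3 is never vacuous).
HONEST LABEL: HC_CM is proved only modulo the 7 printed citations (2 remaining named inputs: hLiu418 = `stmt-HodgeConjecture-24832`, h413 = `stmt-HodgeConjecture-24833`) until rung 0
closes; this file asserts no named fact and closes no socket; the one remaining letter at an inert good place is `hω` (the section's equivariance, (a-2)'s transport); count-neutral.

## References
* [Rogawski1990] J. D. Rogawski, *Automorphic Representations of Unitary Groups in Three Variables*, Ann. of Math. Stud. 123 (1990), §1.10 p. 9, §4.5 p. 45, §13.9 p. 229.
* [Casselman1980] W. Casselman, *The unramified principal series of p-adic groups I*, Compositio Math. 40 (1980), §3.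
-/

set_option autoImplicit false
set_option linter.dupNamespace false -- the mandated namespace repeats `HodgeConjecture.HodgeConjecture`

noncomputable section

open NumberField IsDedekindDomain
open scoped NNReal Matrix
open Literature.NumberTheory.Automorphic Literature.NumberTheory.Automorphic.UnitaryGroup
open Literature.NumberTheory.GaloisRepresentations.IsNonarchimedeanLocalField
open Summit.HodgeConjecture.HodgeConjecture.Cruxes.H413.K2E1BigCellIwasawaTorusEntryU3
open Summit.HodgeConjecture.HodgeConjecture.Cruxes.H413.K2E1BigCellIwasawaTorusEntryU3Letters

namespace Summit.HodgeConjecture.HodgeConjecture.Cruxes.H413.K2E1BigCellIwasawaTorusEntryU3Witness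

variable (L : Type) [Field L] [NumberField L] [IsCMField L] {δ : L} (hcδ : IsCMField.complexConj L δ = -δ) (hδ : δ ≠ 0)
  {d : ↥(maximalRealSubfield L)} (hd : δ * δ = algebraMap ↥(maximalRealSubfield L) L d)
  (v : HeightOneSpectrum (𝓞 ↥(maximalRealSubfield L))) (w : PlacesOver L v)

/-! ## The inert witness of ★ `hin_of_torusEntries` and the existence of `w₀` -/

include hd in
/-- **THE INERT TORUS-ENTRY WITNESS, PACKAGED** — the `hT v hv w hw` body of ★ `K2E1ChiLocalMeansOfShellU3Letters.hin_of_torusEntries` (`∃ α, (α) ∧ (c-on) ∧ (c-off)`), BYTE FOR BYTE at a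
good inert place, for ANY character `χw : L_w^× →* ℂ^×` (the consumer's `φ.localComponent w.1`) and ANY weight `ω : L⁺_v³ → ℂ` that is READ ON THE BOREL PART OF ANY IWASAWA FACTORISATION:
`hω : ∀ p n, n = u(X(p), Z(p)) → ∀ b k t, b ∈ B(L⁺_v) → k ∈ K_v → w₀·n = b·k → (b₀₀)_w = t → ω(p) = χw(t)` — which is what right-`K_v`-invariance and `(B, χ)`-equivariance of the
consumer's section give in one line (the trivial factorisation `b = 1`, `k = w₀·n` on the unit shell yields `ω = χw(1) = 1`).  Torus entry `α(p) = σ(Z(p))_w⁻¹` off the unit shell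
(HEAD `exists_torusEntry_iwasawa_letters`). [cite: Rogawski1990, §4.5 p. 45; §13.9 p. 229] [cite: Casselman1980, §3] -/
theorem exists_inert_torusEntry_witness (hunr : Algebra.IsUnramifiedIn (𝓞 L) v.asIdeal) (hw : IsCMField.complexConj L • w.1 = w.1)
    (h2 : Valued.v (2 : v.adicCompletion ↥(maximalRealSubfield L)) = 1) (hδu : Valued.v (algebraMap L (LocalRing L v) δ w) = 1)
    {w₀ : ↥(unitaryGroupOfForm (conjLocal L (IsCMField.complexConj L) v) (cmLocalForm L 3 v))}
    (hw₀ : (w₀ : GL (Fin 3) (LocalRing L v)).val = !![(0 : LocalRing L v), 0, 1; 0, 1, 0; 1, 0, 0])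
    (χw : (w.1.adicCompletion L)ˣ →* ℂˣ) (ω : (Fin 3 → v.adicCompletion ↥(maximalRealSubfield L)) → ℂ)
    (hω : ∀ p : Fin 3 → v.adicCompletion ↥(maximalRealSubfield L), ∀ n : ↥(unitaryGroupOfForm (conjLocal L (IsCMField.complexConj L) v) (cmLocalForm L 3 v)),
      (n : GL (Fin 3) (LocalRing L v)).val = !![1, quadraticLocalEquiv L v (IsCMField.complexConj L) hcδ hδ (p 0, p 1),
          toLocalRing L v (p 2) * algebraMap L (LocalRing L v) δ -
            toLocalRing L v 2⁻¹ * (quadraticLocalEquiv L v (IsCMField.complexConj L) hcδ hδ (p 0, p 1) * conjLocal L (IsCMField.complexConj L) v (quadraticLocalEquiv L v (IsCMField.complexConj L) hcδ hδ (p 0, p 1)));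
          0, 1, -conjLocal L (IsCMField.complexConj L) v (quadraticLocalEquiv L v (IsCMField.complexConj L) hcδ hδ (p 0, p 1)); 0, 0, 1] →
      ∀ b k : ↥(unitaryGroupOfForm (conjLocal L (IsCMField.complexConj L) v) (cmLocalForm L 3 v)), ∀ t : (w.1.adicCompletion L)ˣ,
        b ∈ borelU (conjLocal L (IsCMField.complexConj L) v) (cmLocalForm L 3 v) →
        k ∈ cmLocalIntegralLevel L 3 (Matrix.of fun i j : Fin 3 => if i.val + j.val + 1 = 3 then (1 : L) else 0) v →
        w₀ * n = b * k → (b : GL (Fin 3) (LocalRing L v)).val 0 0 w = (t : w.1.adicCompletion L) → ω p = ((χw t : ℂˣ) : ℂ)) :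
    ∃ α : (Fin 3 → v.adicCompletion ↥(maximalRealSubfield L)) → (w.1.adicCompletion L)ˣ,
      (∀ p : Fin 3 → v.adicCompletion ↥(maximalRealSubfield L), 1 < (∏ w' : PlacesOver L v, max 1 (max ((normAbs (w'.1.adicCompletion L) (quadraticLocalEquiv L v (IsCMField.complexConj L) hcδ hδ (p 0, p 1) w') : ℝ≥0) : ℝ)
          ((normAbs (w'.1.adicCompletion L) ((toLocalRing L v (p 2) * algebraMap L (LocalRing L v) δ -
            toLocalRing L v 2⁻¹ * (quadraticLocalEquiv L v (IsCMField.complexConj L) hcδ hδ (p 0, p 1) *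
              conjLocal L (IsCMField.complexConj L) v (quadraticLocalEquiv L v (IsCMField.complexConj L) hcδ hδ (p 0, p 1)))) w') : ℝ≥0) : ℝ))) →
        ((normAbs (w.1.adicCompletion L) (α p : w.1.adicCompletion L) : ℝ≥0) : ℝ) * (∏ w' : PlacesOver L v, max 1 (max ((normAbs (w'.1.adicCompletion L) (quadraticLocalEquiv L v (IsCMField.complexConj L) hcδ hδ (p 0, p 1) w') : ℝ≥0) : ℝ)
          ((normAbs (w'.1.adicCompletion L) ((toLocalRing L v (p 2) * algebraMap L (LocalRing L v) δ -
            toLocalRing L v 2⁻¹ * (quadraticLocalEquiv L v (IsCMField.complexConj L) hcδ hδ (p 0, p 1) *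
              conjLocal L (IsCMField.complexConj L) v (quadraticLocalEquiv L v (IsCMField.complexConj L) hcδ hδ (p 0, p 1)))) w') : ℝ≥0) : ℝ))) = 1) ∧
      (∀ p : Fin 3 → v.adicCompletion ↥(maximalRealSubfield L), (∏ w' : PlacesOver L v, max 1 (max ((normAbs (w'.1.adicCompletion L) (quadraticLocalEquiv L v (IsCMField.complexConj L) hcδ hδ (p 0, p 1) w') : ℝ≥0) : ℝ)
          ((normAbs (w'.1.adicCompletion L) ((toLocalRing L v (p 2) * algebraMap L (LocalRing L v) δ -
            toLocalRing L v 2⁻¹ * (quadraticLocalEquiv L v (IsCMField.complexConj L) hcδ hδ (p 0, p 1) *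
              conjLocal L (IsCMField.complexConj L) v (quadraticLocalEquiv L v (IsCMField.complexConj L) hcδ hδ (p 0, p 1)))) w') : ℝ≥0) : ℝ))) = 1 → ω p = 1) ∧
      (∀ p : Fin 3 → v.adicCompletion ↥(maximalRealSubfield L), 1 < (∏ w' : PlacesOver L v, max 1 (max ((normAbs (w'.1.adicCompletion L) (quadraticLocalEquiv L v (IsCMField.complexConj L) hcδ hδ (p 0, p 1) w') : ℝ≥0) : ℝ)
          ((normAbs (w'.1.adicCompletion L) ((toLocalRing L v (p 2) * algebraMap L (LocalRing L v) δ -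
            toLocalRing L v 2⁻¹ * (quadraticLocalEquiv L v (IsCMField.complexConj L) hcδ hδ (p 0, p 1) *
              conjLocal L (IsCMField.complexConj L) v (quadraticLocalEquiv L v (IsCMField.complexConj L) hcδ hδ (p 0, p 1)))) w') : ℝ≥0) : ℝ))) →
        ω p = ((χw (α p) : ℂˣ) : ℂ)) := by
  obtain ⟨α, hα, hoff, hon⟩ := exists_torusEntry_iwasawa_letters L hcδ hδ hd v w hunr hw h2 hδu hw₀
  refine ⟨α, hα, fun p hQ => ?_, fun p hQ => ?_⟩
  · -- unit shell: the trivial factorisation `w₀·u = 1·(w₀·u)`, `(1)₀₀ = 1`, so `ω = χw(1) = 1`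
    obtain ⟨n, hn⟩ := exists_heis_of_corner L hcδ v (quadraticLocalEquiv L v (IsCMField.complexConj L) hcδ hδ (p 0, p 1)) (p 2)
    have h := hω p n hn 1 (w₀ * n) 1 (Subgroup.one_mem _) (hon p hQ n hn) (by rw [one_mul]) (by
      rw [Subgroup.coe_one, Units.val_one, Matrix.one_apply_eq, Pi.one_apply, Units.val_one])
    rw [h, map_one, Units.val_one]
  · obtain ⟨n, hn⟩ := exists_heis_of_corner L hcδ v (quadraticLocalEquiv L v (IsCMField.complexConj L) hcδ hδ (p 0, p 1)) (p 2)
    obtain ⟨b, k, hbB, hkK, hwn, hb⟩ := hoff p hQ n hn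
    exact hω p n hn b k (α p) hbB hkK hwn hb

/-- **AN ELEMENT `w₀ ∈ U(Φ₃)(L⁺_v)` OF MATRIX `Φ₃` EXISTS** at every finite place `v` (inverse matrix `Φ₃`; unitarity `ᵗ(σΦ₃)·Φ₃·Φ₃ = Φ₃`) — the `w₀` parameter of this file and of ★ FILE 1 is never
vacuous (it is ★ `weylLongU` under the `Field` instance of ★ `U3LocalBruhatDecomposition_holds`, or the local image of the global `ι(w₀)`). [cite: Rogawski1990, §1.10 p. 9] -/
theorem exists_antidiag :
    ∃ w₀ : ↥(unitaryGroupOfForm (conjLocal L (IsCMField.complexConj L) v) (cmLocalForm L 3 v)),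
      (w₀ : GL (Fin 3) (LocalRing L v)).val = !![(0 : LocalRing L v), 0, 1; 0, 1, 0; 1, 0, 0] := by
  have hsq : (!![(0 : LocalRing L v), 0, 1; 0, 1, 0; 1, 0, 0] : Matrix (Fin 3) (Fin 3) (LocalRing L v)) * !![(0 : LocalRing L v), 0, 1; 0, 1, 0; 1, 0, 0] = 1 := by
    ext i j
    fin_cases i <;> fin_cases j <;> simp [Matrix.mul_apply, Fin.sum_univ_three]
  refine ⟨⟨⟨_, _, hsq, hsq⟩, ?_⟩, rfl⟩
  rw [mem_unitaryGroupOfForm_iff, cmLocalForm_eq_over, Literature.NumberTheory.QuadraticForms.HermitianUnimodularRamified.antidiagonal_three_over]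
  ext i j
  fin_cases i <;> fin_cases j <;> simp [Matrix.mul_apply, Fin.sum_univ_three, Matrix.map_apply]

include hd in
/-- **THE LAST INERT LETTER `hω` DISCHARGED FOR A SPHERICAL `(B, χ)`-EQUIVARIANT LOCAL SECTION.**  Let `φ : U(Φ₃)(L⁺_v) → ℂ` be right-`K_v`-invariant (`hR`), `(B, χ)`-equivariant with the
Borel character read at `w` on the first diagonal entry (`hE : φ(b·g) = χw(t)·φ(g)` whenever `b ∈ B`, `(b₀₀)_w = t`), and normalised `φ(1) ≠ 0`; let the weight `ω` be the big-cell reading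
`ω(p)·φ(1) = φ(w₀·u(X(p), Z(p)))` (`hωφ`, for every element of that matrix).  THEN `ω` is read on the Borel part of ANY Iwasawa factorisation — the hypothesis `hω` of
`exists_inert_torusEntry_witness` — hence the inert witness `∃ α, (α) ∧ (c-on) ∧ (c-off)` of ★ `hin_of_torusEntries` holds for `(χw, ω)`.  (`φ(w₀u) = φ(bk) = χw(t)φ(k) = χw(t)φ(1)`.)
[cite: Rogawski1990, §4.5 p. 45; §13.9 p. 229] [cite: Casselman1980, §3] -/
theorem exists_inert_torusEntry_witness_of_section (hunr : Algebra.IsUnramifiedIn (𝓞 L) v.asIdeal) (hw : IsCMField.complexConj L • w.1 = w.1)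
    (h2 : Valued.v (2 : v.adicCompletion ↥(maximalRealSubfield L)) = 1) (hδu : Valued.v (algebraMap L (LocalRing L v) δ w) = 1)
    {w₀ : ↥(unitaryGroupOfForm (conjLocal L (IsCMField.complexConj L) v) (cmLocalForm L 3 v))}
    (hw₀ : (w₀ : GL (Fin 3) (LocalRing L v)).val = !![(0 : LocalRing L v), 0, 1; 0, 1, 0; 1, 0, 0])
    (χw : (w.1.adicCompletion L)ˣ →* ℂˣ) (φ : ↥(unitaryGroupOfForm (conjLocal L (IsCMField.complexConj L) v) (cmLocalForm L 3 v)) → ℂ) (hφ1 : φ 1 ≠ 0)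
    (hR : ∀ g k : ↥(unitaryGroupOfForm (conjLocal L (IsCMField.complexConj L) v) (cmLocalForm L 3 v)),
      k ∈ cmLocalIntegralLevel L 3 (Matrix.of fun i j : Fin 3 => if i.val + j.val + 1 = 3 then (1 : L) else 0) v → φ (g * k) = φ g)
    (hE : ∀ b g : ↥(unitaryGroupOfForm (conjLocal L (IsCMField.complexConj L) v) (cmLocalForm L 3 v)), ∀ t : (w.1.adicCompletion L)ˣ,
      b ∈ borelU (conjLocal L (IsCMField.complexConj L) v) (cmLocalForm L 3 v) → (b : GL (Fin 3) (LocalRing L v)).val 0 0 w = (t : w.1.adicCompletion L) →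
      φ (b * g) = ((χw t : ℂˣ) : ℂ) * φ g)
    (ω : (Fin 3 → v.adicCompletion ↥(maximalRealSubfield L)) → ℂ)
    (hωφ : ∀ p : Fin 3 → v.adicCompletion ↥(maximalRealSubfield L), ∀ n : ↥(unitaryGroupOfForm (conjLocal L (IsCMField.complexConj L) v) (cmLocalForm L 3 v)),
      (n : GL (Fin 3) (LocalRing L v)).val = !![1, quadraticLocalEquiv L v (IsCMField.complexConj L) hcδ hδ (p 0, p 1),
          toLocalRing L v (p 2) * algebraMap L (LocalRing L v) δ -
            toLocalRing L v 2⁻¹ * (quadraticLocalEquiv L v (IsCMField.complexConj L) hcδ hδ (p 0, p 1) * conjLocal L (IsCMField.complexConj L) v (quadraticLocalEquiv L v (IsCMField.complexConj L) hcδ hδ (p 0, p 1)));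
          0, 1, -conjLocal L (IsCMField.complexConj L) v (quadraticLocalEquiv L v (IsCMField.complexConj L) hcδ hδ (p 0, p 1)); 0, 0, 1] →
      ω p * φ 1 = φ (w₀ * n)) :
    ∃ α : (Fin 3 → v.adicCompletion ↥(maximalRealSubfield L)) → (w.1.adicCompletion L)ˣ,
      (∀ p : Fin 3 → v.adicCompletion ↥(maximalRealSubfield L), 1 < (∏ w' : PlacesOver L v, max 1 (max ((normAbs (w'.1.adicCompletion L) (quadraticLocalEquiv L v (IsCMField.complexConj L) hcδ hδ (p 0, p 1) w') : ℝ≥0) : ℝ)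
          ((normAbs (w'.1.adicCompletion L) ((toLocalRing L v (p 2) * algebraMap L (LocalRing L v) δ -
            toLocalRing L v 2⁻¹ * (quadraticLocalEquiv L v (IsCMField.complexConj L) hcδ hδ (p 0, p 1) *
              conjLocal L (IsCMField.complexConj L) v (quadraticLocalEquiv L v (IsCMField.complexConj L) hcδ hδ (p 0, p 1)))) w') : ℝ≥0) : ℝ))) →
        ((normAbs (w.1.adicCompletion L) (α p : w.1.adicCompletion L) : ℝ≥0) : ℝ) * (∏ w' : PlacesOver L v, max 1 (max ((normAbs (w'.1.adicCompletion L) (quadraticLocalEquiv L v (IsCMField.complexConj L) hcδ hδ (p 0, p 1) w') : ℝ≥0) : ℝ)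
          ((normAbs (w'.1.adicCompletion L) ((toLocalRing L v (p 2) * algebraMap L (LocalRing L v) δ -
            toLocalRing L v 2⁻¹ * (quadraticLocalEquiv L v (IsCMField.complexConj L) hcδ hδ (p 0, p 1) *
              conjLocal L (IsCMField.complexConj L) v (quadraticLocalEquiv L v (IsCMField.complexConj L) hcδ hδ (p 0, p 1)))) w') : ℝ≥0) : ℝ))) = 1) ∧
      (∀ p : Fin 3 → v.adicCompletion ↥(maximalRealSubfield L), (∏ w' : PlacesOver L v, max 1 (max ((normAbs (w'.1.adicCompletion L) (quadraticLocalEquiv L v (IsCMField.complexConj L) hcδ hδ (p 0, p 1) w') : ℝ≥0) : ℝ)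
          ((normAbs (w'.1.adicCompletion L) ((toLocalRing L v (p 2) * algebraMap L (LocalRing L v) δ -
            toLocalRing L v 2⁻¹ * (quadraticLocalEquiv L v (IsCMField.complexConj L) hcδ hδ (p 0, p 1) *
              conjLocal L (IsCMField.complexConj L) v (quadraticLocalEquiv L v (IsCMField.complexConj L) hcδ hδ (p 0, p 1)))) w') : ℝ≥0) : ℝ))) = 1 → ω p = 1) ∧
      (∀ p : Fin 3 → v.adicCompletion ↥(maximalRealSubfield L), 1 < (∏ w' : PlacesOver L v, max 1 (max ((normAbs (w'.1.adicCompletion L) (quadraticLocalEquiv L v (IsCMField.complexConj L) hcδ hδ (p 0, p 1) w') : ℝ≥0) : ℝ)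
          ((normAbs (w'.1.adicCompletion L) ((toLocalRing L v (p 2) * algebraMap L (LocalRing L v) δ -
            toLocalRing L v 2⁻¹ * (quadraticLocalEquiv L v (IsCMField.complexConj L) hcδ hδ (p 0, p 1) *
              conjLocal L (IsCMField.complexConj L) v (quadraticLocalEquiv L v (IsCMField.complexConj L) hcδ hδ (p 0, p 1)))) w') : ℝ≥0) : ℝ))) →
        ω p = ((χw (α p) : ℂˣ) : ℂ)) := by
  refine exists_inert_torusEntry_witness L hcδ hδ hd v w hunr hw h2 hδu hw₀ χw ω fun p n hn b k t hbB hkK hwn hb => ?_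
  -- `ω(p)·φ(1) = φ(w₀ n) = φ(b k) = χw(t)·φ(k) = χw(t)·φ(1·k) = χw(t)·φ(1)`
  have h := hωφ p n hn
  rw [hwn, hE b k t hbB hb, ← one_mul k, hR 1 k hkK] at h
  exact mul_right_cancel₀ hφ1 h

end Summit.HodgeConjecture.HodgeConjecture.Cruxes.H413.K2E1BigCellIwasawaTorusEntryU3Witness

end
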